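import Literature.NumberTheory.LFunctions.MatomakiRadziwillTaoT2OfVK
import Literature.NumberTheory.LFunctions.VinogradovZetaSumEstimate
import HarnessLib

/-!
# Parity wave 0, S21 — Tao's logarithmically averaged two-point Chowla theorems, proved:
# `tao_log_chowla_liouville_holds`, `tao_log_chowla_moebius_holds`

Topic `Literature/NumberTheory/Sieve`; sibling proof file (two theorems, no definitions, no named facts) of
`ParityWave0.lean` for the Wave-0 named facts

* `Literature.NumberTheory.Sieve.tao_log_chowla_liouville` (**parity.S21**; T. Tao, *The logarithmically averaged
  Chowla and Elliott conjectures for two-point correlations*, Forum Math. Pi 4 (2016) e8, Theorem 1.2 / Corollary 1.5: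
  `∑_{n ≤ x} λ(a₁n + b₁) λ(a₂n + b₂)/n = o(log x)` for `a₁b₂ ≠ a₂b₁`),
* `Literature.NumberTheory.Sieve.tao_log_chowla_moebius` (**parity.S21**; ibid., §1 after Remark 1.6:
  `∑_{n ≤ x} μ(n) μ(n+h)/n = o(log x)` for every `h ≥ 1`).

The tree already proves both from ANY Vinogradov–Korobov zero-free region for Dirichlet `L`-functions
(`Literature.NumberTheory.LFunctions.MRT2015.tao_log_chowla_liouville_of_vk`, `…tao_log_chowla_moebius_of_vk`, file
`Literature/NumberTheory/LFunctions/MatomakiRadziwillTaoT2OfVK.lean`: Matomäki–Radziwiłł–Tao 2015, Proposition A.3 in the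
restricted-Halász form `PropA3With (fun M => K (1 + M) e^{-M/2})` → Theorem A.2 → MRT Theorem 1.7 (saving `e^{-M/120}`) →
Tao's Proposition 2.4 → Theorem 2.3 → Theorem 1.3 → Corollary 1.5, and Theorem 1.3 → the Möbius form), and it proves such
a region unconditionally (`Literature.NumberTheory.LFunctions.VKZeta.exists_hasVKZeroFreeRegion :
∃ c > 0, HasVKZeroFreeRegion c 21`, file `VinogradovZetaSumEstimate.lean`, from the tree's Vinogradov mean value theorem
through Ivić's Theorem 6.2).  The two modules do not import each other; this file only joins them.  In particular the
named fact `Literature.NumberTheory.LFunctions.MatomakiRadziwillTao2015_propA3` (Proposition A.3 with the printed middle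
term `e^{-M} M`) is NOT needed on this path and is not used here.

The `LFunctions`-side facts of the same chain (`Tao2016_prop24`, `Tao2016_theorem23`, `tao_log_averaged_elliott_two`,
`tao_log_chowla_two`) are discharged in `Literature/NumberTheory/LFunctions/TaoLogElliottHolds.lean`.

## References
* T. Tao, Forum Math. Pi 4 (2016), e8: Theorem 1.2, Corollary 1.5, Theorem 1.3, and §1 after Remark 1.6.
  [cite: TaoFMP2016, Theorem 1.2 and Corollary 1.5]
* K. Matomäki, M. Radziwiłł, T. Tao, Algebra & Number Theory 9 (2015) (arXiv:1503.05121), Appendix A.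
  [cite: MatomakiRadziwillTao2015, Appendix A, Proposition A.3]

## Design choices
* No new statements: each theorem is a term joining two tree theorems; its axiom closure is that of its inputs.
-/

namespace Literature.NumberTheory.Sieve

open Literature.NumberTheory.LFunctions

/-- **parity.S21 (Liouville), PROVED** — Tao 2016, Theorem 1.2 / Corollary 1.5: for `a₁, a₂ ≥ 1`, `a₁b₂ ≠ a₂b₁`,
`∑_{n ≤ x} λ(a₁n + b₁) λ(a₂n + b₂)/n = o(log x)` (discharge of the named fact `tao_log_chowla_liouville`):
`MRT2015.tao_log_chowla_liouville_of_vk` at the tree's unconditional Vinogradov–Korobov region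
`VKZeta.exists_hasVKZeroFreeRegion`. [cite: TaoFMP2016, Theorem 1.2 and Corollary 1.5] -/
theorem tao_log_chowla_liouville_holds : tao_log_chowla_liouville := by
  obtain ⟨c, hc, hVK⟩ := VKZeta.exists_hasVKZeroFreeRegion
  exact MRT2015.tao_log_chowla_liouville_of_vk hc hVK

/-- **parity.S21 (Möbius), PROVED** — Tao 2016, §1 (after Remark 1.6): for every `h ≥ 1`,
`∑_{n ≤ x} μ(n) μ(n+h)/n = o(log x)` (discharge of the named fact `tao_log_chowla_moebius`):
`MRT2015.tao_log_chowla_moebius_of_vk` at the tree's unconditional Vinogradov–Korobov region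
`VKZeta.exists_hasVKZeroFreeRegion`. [cite: TaoFMP2016, §1 (Corollary 1.5)] -/
theorem tao_log_chowla_moebius_holds : tao_log_chowla_moebius := by
  obtain ⟨c, hc, hVK⟩ := VKZeta.exists_hasVKZeroFreeRegion
  exact MRT2015.tao_log_chowla_moebius_of_vk hc hVK

end Literature.NumberTheory.Sieve
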